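import Mathlib
import Summits.AtomisticToContinuum.Crystallization.Theses.ChessboardParticlePlanes
import Summits.AtomisticToContinuum.Crystallization.Theorems.ChessboardParticlePlanesLjLaminarWindowsMassBound
import HarnessLib

/-! # A far particle — stub `stub_farParticle` of line `Sketch` (skeleton rev. 17, lead c11),
crux `LjLaminarWindows` (stmt-AtomisticToContinuum-6711)

Packing fact used by the glue `stub_cruxOfOneWindow`: in a `7/10`-separated configuration of
`N > (40L/7 + 1)³` points every particle `p₀` sees a particle beyond distance `2L`.  Otherwise all `N`
points lie in the closed `2L`-ball about `x p₀`, whose particle count is at most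
`(2·(2L)/(7/10) + 1)³ < N` by the packing bound `glue_ball_card_le` (injectivity from separation,
`massBound_injective`). -/

noncomputable section

open scoped BigOperators
open Filter Topology
open Literature.MathematicalPhysics.StatisticalMechanics
open Summit.AtomisticToContinuum.Crystallization.Theorems.ChargedEnergyGapNegative

namespace Summit.AtomisticToContinuum.Crystallization.Theorems.LjLaminarWindowsSketch

/-- **Registered stub `stub_farParticle` of skeleton rev. 17 (line `Sketch`) — a far particle.** In a
`7/10`-separated configuration of `N > (40L/7 + 1)³` points every particle sees a particle beyond
distance `2L` (packing bound `glue_ball_card_le` for the closed `2L`-ball; injectivity from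
separation, `massBound_injective`). [folklore] -/
theorem stub_farParticle :
    ∀ (N : ℕ) (x : Fin N → E3), (∀ j k : Fin N, j ≠ k → (7 : ℝ) / 10 ≤ dist (x j) (x k)) →
      ∀ L : ℝ, 0 ≤ L → (2 * (2 * L) / (7 / 10) + 1) ^ 3 < (N : ℝ) →
        ∀ p₀ : Fin N, ∃ j : Fin N, 2 * L < dist (x j) (x p₀) := by
  intro N x hsep L hL hN p₀
  by_contra hfar
  push Not at hfar
  have hball := glue_ball_card_le N x (massBound_injective x hsep) (by norm_num : (0 : ℝ) < 7 / 10)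
    hsep (x p₀) (L := 2 * L) (by positivity)
  have hfilter : (Finset.univ.filter fun j : Fin N => dist (x j) (x p₀) ≤ 2 * L) = Finset.univ :=
    Finset.filter_true_of_mem fun j _ => hfar j
  rw [hfilter, Finset.card_univ, Fintype.card_fin] at hball
  linarith

end Summit.AtomisticToContinuum.Crystallization.Theorems.LjLaminarWindowsSketch

end
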